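import Mathlib
import Summits.NavierStokesRegularity.NavierStokesRegularity.Theorems.WakeRatchetTailRatchetEternalGap
import Summits.NavierStokesRegularity.NavierStokesRegularity.Theorems.WakeRatchetAdmissibleEternalBoundOrthant
import HarnessLib

/-!
# `WakeRatchet.TailRatchet` (stmt-NavierStokesRegularity-21808): the GAP THEOREM for the FULL hypothesis
# class of the crux — bounded admissible eternal solutions with ANY covariant viscosity `ν̂ ≥ 0`

Support file for the crux `TailRatchet` (route `WakeRatchet`; MODEL lattice ODEs of Tao 2016 §4 —
nothing in this file is a statement about the Navier–Stokes equations, and no item is closed here).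

`TailRatchet` (and `TailRateRatchet` stmt-25584, `EternalViscousRate` stmt-25647) quantify over
`IsEternalVisc ε₀ ν̂ α W` with `UniformBound W`.  The companion file `WakeRatchetTailRatchetEternalGap`
proves the amplitude gap for `ν̂ = 0`.  Here the covariant dissipation is added: by the tree's
far-past decay `‖W_k(σ)‖ ≤ C_A Λ B² e^{σ}/(ν̂ (1+ε₀)^{2k})` (`farPastDecay_all`) the dissipation density
`ν̂(1+ε₀)^{2k}e^{−σ}‖W_k‖²` is integrable over the whole log-time line, the shell balance becomes
`∫‖W_n‖² + D_n = Λ·I_{n−1} − Λ⁻¹·I_n` with `D_n ≥ 0` (`shell_balance_visc`), and the one-step recursion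
and the gap follow verbatim:

* `eq_zero_of_small_bound_visc` (`ν̂ > 0`), `eq_zero_of_small_bound_all` (every `ν̂ ≥ 0`):
  `(Λ + Λ⁻¹)·fluxConst α·C < 1 ⇒ W ≡ 0`;
* `gap_comparable_all` — on a cancelling `R`-comparable table (`m = 4`), `0 < ε₀ ≤ 1`, any `ν̂`:
  a non-trivial uniformly bounded admissible eternal solution has every uniform bound `C > 1/576`;
* `tailRatchet_scope_gap` — the same, with the hypotheses spelled exactly as in the crux
  (`InTableClass R α`, `IsEternalVisc ε₀ ν̂ α W`): `∃ n σ, 1/576 < ‖W n σ‖`.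

READING FOR THE CENSUS of stmt-21808: the whole scope of the crux has an `ε₀`-UNIFORM amplitude gap
`1/576`; the objects that would refute it (persistent fronts with wake fraction `→ 0`) are in addition
forced to size `≳ ε₀⁻¹` when self-similar (`WakeRatchetTailRatchetDSSAmplitudeFloor`).

HONEST FRAMING: elementary real analysis on the cell's lemma layer; MODEL lattice only.
-/

noncomputable section

set_option linter.dupNamespace false

namespace Summit.NavierStokesRegularity.NavierStokesRegularity.Theorems

namespace WakeRatchetEternalGapVisc

open MeasureTheory Set Filter Topology
open scoped RealInnerProductSpace
open Literature.Analysis.FluidPDE Literature.Analysis.FluidPDE.TaoCascade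
open WakeRatchetEternalActionSummable WakeRatchetEternalGap

variable {m : ℕ} {ε₀ νh : ℝ} {α : Fin m → Fin m → Fin m → ℤ × ℤ × ℤ → ℝ} {W : ℤ → ℝ → Em m}

/-- `σ ↦ ‖W_n(σ)‖²` is integrable (viscous case). [cite: Tao2016AveragedNS, §4 Lemma 4.1 (4.8); cell lemma] -/
theorem integrable_norm_sq_visc (hW : IsEternalVisc ε₀ νh α W) {C : ℝ} (hC : ∀ k σ, ‖W k σ‖ ≤ C)
    (n : ℤ) : Integrable (fun σ => ‖W n σ‖ ^ 2) := by
  obtain ⟨M, hM⟩ := hW.action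
  refine Integrable.mono' ((hM n).1.const_mul C)
    (((WakeRatchetOrthant.continuous_shell hW n).norm.pow 2).aestronglyMeasurable) (Eventually.of_forall fun σ => ?_)
  rw [Real.norm_eq_abs, abs_of_nonneg (by positivity), sq]
  exact mul_le_mul_of_nonneg_right (hC n σ) (norm_nonneg _)

/-- The flux pairing is integrable (viscous case). [cite: Tao2016AveragedNS, §4 Lemma 4.1 (4.9); cell lemma] -/
theorem integrable_flux_visc (hW : IsEternalVisc ε₀ νh α W) (hc : IsCancellingCoeff α) {C : ℝ}
    (hC : ∀ k σ, ‖W k σ‖ ≤ C) (n : ℤ) :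
    Integrable (fun σ => ⟪W (n + 1) σ, tableA α (W n σ)⟫) := by
  have hS := table_sTable α hc
  refine Integrable.mono' ((integrable_norm_sq_visc hW hC n).const_mul (fluxConst α * C))
    (((WakeRatchetOrthant.continuous_shell hW (n + 1)).inner
      (hS.contA.comp (WakeRatchetOrthant.continuous_shell hW n))).aestronglyMeasurable)
    (Eventually.of_forall fun σ => ?_)
  rw [Real.norm_eq_abs]
  exact abs_flux_le hc hC n σ

/-- `|∫⟪W_{n+1}, A W_n⟫| ≤ fluxConst α·C·∫‖W_n‖²` (viscous case). [cite: Tao2016AveragedNS, §4 Lemma 4.1 (4.9); cell lemma] -/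
theorem abs_integral_flux_le_visc (hW : IsEternalVisc ε₀ νh α W) (hc : IsCancellingCoeff α) {C : ℝ}
    (hC : ∀ k σ, ‖W k σ‖ ≤ C) (n : ℤ) :
    |∫ σ, ⟪W (n + 1) σ, tableA α (W n σ)⟫| ≤ fluxConst α * C * ∫ σ, ‖W n σ‖ ^ 2 := by
  calc |∫ σ, ⟪W (n + 1) σ, tableA α (W n σ)⟫| ≤ ∫ σ, |⟪W (n + 1) σ, tableA α (W n σ)⟫| := by
        simpa only [Real.norm_eq_abs] using
          norm_integral_le_integral_norm (fun σ => ⟪W (n + 1) σ, tableA α (W n σ)⟫)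
    _ ≤ ∫ σ, fluxConst α * C * ‖W n σ‖ ^ 2 :=
        integral_mono (integrable_flux_visc hW hc hC n).abs
          ((integrable_norm_sq_visc hW hC n).const_mul _) fun σ => abs_flux_le hc hC n σ
    _ = fluxConst α * C * ∫ σ, ‖W n σ‖ ^ 2 := integral_const_mul _ _

/-- **Unweighted shell energy identity with covariant viscosity**:
`d/dσ ‖W_n‖² = −2‖W_n‖² + 2Λ⟪W_n, A W_{n−1}⟫ − 2Λ⁻¹⟪W_{n+1}, A W_n⟫ − 2·viscCoef·‖W_n‖²`.
[cite: Tao2016AveragedNS, §4 (4.3), Lemma 4.1 (4.8)–(4.10), viscous equation before Thm. 4.2, §6.4; cell lemma] -/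
theorem hasDerivAt_norm_sq_visc (hW : IsEternalVisc ε₀ νh α W) (hc : IsCancellingCoeff α) (n : ℤ)
    (σ : ℝ) :
    HasDerivAt (fun x => ‖W n x‖ ^ 2)
      (-2 * ‖W n σ‖ ^ 2 + 2 * bigLam ε₀ * ⟪W n σ, tableA α (W (n - 1) σ)⟫
        - 2 * (bigLam ε₀)⁻¹ * ⟪W (n + 1) σ, tableA α (W n σ)⟫
        - 2 * viscCoef ε₀ νh n σ * ‖W n σ‖ ^ 2) σ := by
  have hS := table_sTable α hc
  refine ((hW.law n σ).norm_sq).congr_deriv ?_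
  rw [inner_sub_right, inner_add_right, inner_add_right, inner_add_right, inner_neg_right,
    real_inner_smul_right, real_inner_smul_right, real_inner_smul_right, real_inner_smul_right,
    real_inner_self_eq_norm_sq, hS.intra]
  have hcan := hS.cancel (W n σ) (W (n + 1) σ)
  unfold viscCoef
  linear_combination (2 * (bigLam ε₀)⁻¹) * hcan

/-- **The dissipation density is integrable over the whole log-time line** (`ν̂ > 0`, `ε₀ > 0`):
by the far-past decay `‖W_n(σ)‖ ≤ C_A Λ C² e^{σ}/(ν̂(1+ε₀)^{2n})` one has
`viscCoef·‖W_n‖² ≤ C_A Λ C²·‖W_n‖`, an integrable majorant.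
[cite: Tao2016AveragedNS, §4 Lemma 4.1 (4.8)–(4.10), viscous equation before Thm. 4.2, §6.4; cell lemma] -/
theorem integrable_dissipation (hε : 0 < ε₀) (hν : 0 < νh) (hW : IsEternalVisc ε₀ νh α W)
    (hc : IsCancellingCoeff α) {C : ℝ} (hC : ∀ k σ, ‖W k σ‖ ≤ C) (n : ℤ) :
    Integrable (fun σ => viscCoef ε₀ νh n σ * ‖W n σ‖ ^ 2) := by
  obtain ⟨M, hM⟩ := hW.action
  have hx : 0 < 1 + ε₀ := by linarith
  have hp : 0 < (1 + ε₀) ^ ((2 : ℝ) * (n : ℝ)) := Real.rpow_pos_of_pos hx _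
  have hcont : Continuous (fun σ => viscCoef ε₀ νh n σ * ‖W n σ‖ ^ 2) := by
    unfold viscCoef
    exact (continuous_const.mul (continuous_const.mul (Real.continuous_exp.comp continuous_neg))).mul
      ((WakeRatchetOrthant.continuous_shell hW n).norm.pow 2)
  refine Integrable.mono' ((hM n).1.const_mul (fluxConst α * bigLam ε₀ * C ^ 2))
    hcont.aestronglyMeasurable (Eventually.of_forall fun σ => ?_)
  have hfar := farPastDecay_all hε hν hW hc hC n σ
  have hv0 : 0 ≤ viscCoef ε₀ νh n σ := by unfold viscCoef; positivity
  rw [Real.norm_eq_abs, abs_of_nonneg (by positivity)]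
  -- `viscCoef · ‖W‖² = (viscCoef · ‖W‖) · ‖W‖ ≤ (C_A Λ C²) · ‖W‖`
  have key : viscCoef ε₀ νh n σ * ‖W n σ‖ ≤ fluxConst α * bigLam ε₀ * C ^ 2 := by
    calc viscCoef ε₀ νh n σ * ‖W n σ‖
        ≤ viscCoef ε₀ νh n σ * (fluxConst α * bigLam ε₀ * C ^ 2 * Real.exp σ
            / (νh * (1 + ε₀) ^ ((2 : ℝ) * (n : ℝ)))) := mul_le_mul_of_nonneg_left hfar hv0
      _ = fluxConst α * bigLam ε₀ * C ^ 2 := by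
          unfold viscCoef
          rw [Real.exp_neg]
          field_simp
  calc viscCoef ε₀ νh n σ * ‖W n σ‖ ^ 2 = (viscCoef ε₀ νh n σ * ‖W n σ‖) * ‖W n σ‖ := by ring
    _ ≤ fluxConst α * bigLam ε₀ * C ^ 2 * ‖W n σ‖ :=
        mul_le_mul_of_nonneg_right key (norm_nonneg _)

/-- **Shell balance with dissipation**: `∫‖W_n‖² + D_n = Λ ∫⟪W_n, A W_{n−1}⟫ − Λ⁻¹ ∫⟪W_{n+1}, A W_n⟫`
with `D_n = ∫ viscCoef·‖W_n‖² ≥ 0` (`ν̂ > 0`, `ε₀ > 0`).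
[cite: Tao2016AveragedNS, §4 (4.3), Lemma 4.1 (4.9)–(4.10), viscous equation before Thm. 4.2, §6.4; cell theorem] -/
theorem shell_balance_visc (hε : 0 < ε₀) (hν : 0 < νh) (hW : IsEternalVisc ε₀ νh α W)
    (hc : IsCancellingCoeff α) {C : ℝ} (hC : ∀ k σ, ‖W k σ‖ ≤ C) (n : ℤ) :
    (∫ σ, ‖W n σ‖ ^ 2) + ∫ σ, viscCoef ε₀ νh n σ * ‖W n σ‖ ^ 2
      = bigLam ε₀ * (∫ σ, ⟪W n σ, tableA α (W (n - 1) σ)⟫)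
        - (bigLam ε₀)⁻¹ * ∫ σ, ⟪W (n + 1) σ, tableA α (W n σ)⟫ := by
  have hE := integrable_norm_sq_visc hW hC n
  have hF := integrable_flux_visc hW hc hC n
  have hD := integrable_dissipation hε hν hW hc hC n
  have hFm : Integrable (fun σ => ⟪W n σ, tableA α (W (n - 1) σ)⟫) := by
    have h := integrable_flux_visc hW hc hC (n - 1)
    simp only [sub_add_cancel] at h
    exact h
  have i1 : Integrable (fun σ => -2 * ‖W n σ‖ ^ 2) := hE.const_mul _
  have i2 : Integrable (fun σ => 2 * bigLam ε₀ * ⟪W n σ, tableA α (W (n - 1) σ)⟫) := hFm.const_mul _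
  have i3 : Integrable (fun σ => 2 * (bigLam ε₀)⁻¹ * ⟪W (n + 1) σ, tableA α (W n σ)⟫) :=
    hF.const_mul _
  have i4 : Integrable (fun σ => 2 * (viscCoef ε₀ νh n σ * ‖W n σ‖ ^ 2)) := hD.const_mul _
  have hderiv : ∀ σ, HasDerivAt (fun x => ‖W n x‖ ^ 2)
      (-2 * ‖W n σ‖ ^ 2 + 2 * bigLam ε₀ * ⟪W n σ, tableA α (W (n - 1) σ)⟫
        - 2 * (bigLam ε₀)⁻¹ * ⟪W (n + 1) σ, tableA α (W n σ)⟫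
        - 2 * (viscCoef ε₀ νh n σ * ‖W n σ‖ ^ 2)) σ := fun σ =>
    (hasDerivAt_norm_sq_visc hW hc n σ).congr_deriv (by ring)
  have h0 := integral_eq_zero_of_hasDerivAt_of_integrable hderiv (((i1.add i2).sub i3).sub i4) hE
  have h1 : ∫ σ, (-2 * ‖W n σ‖ ^ 2 + 2 * bigLam ε₀ * ⟪W n σ, tableA α (W (n - 1) σ)⟫
      - 2 * (bigLam ε₀)⁻¹ * ⟪W (n + 1) σ, tableA α (W n σ)⟫
      - 2 * (viscCoef ε₀ νh n σ * ‖W n σ‖ ^ 2))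
      = (∫ σ, (-2 * ‖W n σ‖ ^ 2 + 2 * bigLam ε₀ * ⟪W n σ, tableA α (W (n - 1) σ)⟫
          - 2 * (bigLam ε₀)⁻¹ * ⟪W (n + 1) σ, tableA α (W n σ)⟫))
        - ∫ σ, 2 * (viscCoef ε₀ νh n σ * ‖W n σ‖ ^ 2) := integral_sub ((i1.add i2).sub i3) i4
  have h2 : ∫ σ, (-2 * ‖W n σ‖ ^ 2 + 2 * bigLam ε₀ * ⟪W n σ, tableA α (W (n - 1) σ)⟫
      - 2 * (bigLam ε₀)⁻¹ * ⟪W (n + 1) σ, tableA α (W n σ)⟫)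
      = (∫ σ, (-2 * ‖W n σ‖ ^ 2 + 2 * bigLam ε₀ * ⟪W n σ, tableA α (W (n - 1) σ)⟫))
        - ∫ σ, 2 * (bigLam ε₀)⁻¹ * ⟪W (n + 1) σ, tableA α (W n σ)⟫ := integral_sub (i1.add i2) i3
  have h3 : ∫ σ, (-2 * ‖W n σ‖ ^ 2 + 2 * bigLam ε₀ * ⟪W n σ, tableA α (W (n - 1) σ)⟫)
      = (∫ σ, -2 * ‖W n σ‖ ^ 2) + ∫ σ, 2 * bigLam ε₀ * ⟪W n σ, tableA α (W (n - 1) σ)⟫ :=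
    integral_add i1 i2
  rw [h1, h2, h3, integral_const_mul, integral_const_mul, integral_const_mul, integral_const_mul] at h0
  linarith

/-- One-step recursion of shell actions in the viscous case (the dissipation only helps):
`(1 − Λ⁻¹ f C)·∫‖W_n‖² ≤ Λ f C·∫‖W_{n−1}‖²`. [cite: Tao2016AveragedNS, §4 (4.1)–(4.3), Lemma 4.1 (4.9)–(4.10), §6.4; cell theorem] -/
theorem action_sq_step_visc (hε : 0 < ε₀) (hν : 0 < νh) (hW : IsEternalVisc ε₀ νh α W)
    (hc : IsCancellingCoeff α) {C : ℝ} (hC : ∀ k σ, ‖W k σ‖ ≤ C) (n : ℤ) :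
    (1 - (bigLam ε₀)⁻¹ * fluxConst α * C) * ∫ σ, ‖W n σ‖ ^ 2
      ≤ bigLam ε₀ * fluxConst α * C * ∫ σ, ‖W (n - 1) σ‖ ^ 2 := by
  have hΛ : 0 ≤ bigLam ε₀ := (bigLam_pos (by linarith)).le
  have hbal := shell_balance_visc hε hν hW hc hC n
  have hD0 : 0 ≤ ∫ σ, viscCoef ε₀ νh n σ * ‖W n σ‖ ^ 2 :=
    integral_nonneg fun σ => by unfold viscCoef; positivity
  have h1 : |∫ σ, ⟪W n σ, tableA α (W (n - 1) σ)⟫| ≤ fluxConst α * C * ∫ σ, ‖W (n - 1) σ‖ ^ 2 := by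
    have h := abs_integral_flux_le_visc hW hc hC (n - 1)
    simp only [sub_add_cancel] at h
    exact h
  have h2 := abs_integral_flux_le_visc hW hc hC n
  have hb1 : bigLam ε₀ * ∫ σ, ⟪W n σ, tableA α (W (n - 1) σ)⟫
      ≤ bigLam ε₀ * (fluxConst α * C * ∫ σ, ‖W (n - 1) σ‖ ^ 2) :=
    mul_le_mul_of_nonneg_left ((le_abs_self _).trans h1) hΛ
  have hb2 : -((bigLam ε₀)⁻¹ * ∫ σ, ⟪W (n + 1) σ, tableA α (W n σ)⟫)
      ≤ (bigLam ε₀)⁻¹ * (fluxConst α * C * ∫ σ, ‖W n σ‖ ^ 2) := by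
    rw [← mul_neg]
    exact mul_le_mul_of_nonneg_left ((neg_le_abs _).trans h2) (inv_nonneg.2 hΛ)
  have key : ∫ σ, ‖W n σ‖ ^ 2 ≤ bigLam ε₀ * (fluxConst α * C * ∫ σ, ‖W (n - 1) σ‖ ^ 2)
      + (bigLam ε₀)⁻¹ * (fluxConst α * C * ∫ σ, ‖W n σ‖ ^ 2) := by linarith
  have e : (1 - (bigLam ε₀)⁻¹ * fluxConst α * C) * ∫ σ, ‖W n σ‖ ^ 2
      = (∫ σ, ‖W n σ‖ ^ 2) - (bigLam ε₀)⁻¹ * (fluxConst α * C * ∫ σ, ‖W n σ‖ ^ 2) := by ring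
  rw [e]
  linarith

/-- **Gap theorem, viscous case** (`ν̂ > 0`, `ε₀ > 0`): `(Λ + Λ⁻¹)·fluxConst α·C < 1 ⇒ W ≡ 0`.
[cite: Tao2016AveragedNS, §4 (4.1)–(4.3), Lemma 4.1 (4.8)–(4.10), viscous equation before Thm. 4.2, §6.4; cell theorem] -/
theorem eq_zero_of_small_bound_visc (hε : 0 < ε₀) (hν : 0 < νh) (hW : IsEternalVisc ε₀ νh α W)
    (hc : IsCancellingCoeff α) {C : ℝ} (hC : ∀ k σ, ‖W k σ‖ ≤ C)
    (hsmall : (bigLam ε₀ + (bigLam ε₀)⁻¹) * fluxConst α * C < 1) :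
    ∀ (n : ℤ) (σ : ℝ), W n σ = 0 := by
  obtain ⟨M, hM⟩ := hW.action
  have hΛ0 : 0 < bigLam ε₀ := bigLam_pos (by linarith)
  have hf0 : 0 ≤ fluxConst α := (table_sTable α hc).CA_nonneg
  have hC0 : 0 ≤ C := (norm_nonneg _).trans (hC 0 0)
  set J : ℤ → ℝ := fun n => ∫ σ, ‖W n σ‖ ^ 2 with hJ
  have hJ0 : ∀ n, 0 ≤ J n := fun n => integral_nonneg fun σ => by positivity
  have hJB : ∀ n, J n ≤ C * M := by
    intro n
    calc ∫ σ, ‖W n σ‖ ^ 2 ≤ ∫ σ, C * ‖W n σ‖ := by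
          refine integral_mono (integrable_norm_sq_visc hW hC n) ((hM n).1.const_mul C) fun σ => ?_
          simp only [sq]
          exact mul_le_mul_of_nonneg_right (hC n σ) (norm_nonneg _)
      _ = C * ∫ σ, ‖W n σ‖ := integral_const_mul _ _
      _ ≤ C * M := mul_le_mul_of_nonneg_left (hM n).2 hC0
  set a : ℝ := (bigLam ε₀)⁻¹ * fluxConst α * C with ha
  set b : ℝ := bigLam ε₀ * fluxConst α * C with hb
  have hab : a + b < 1 := by rw [ha, hb]; linarith
  have ha0 : 0 ≤ a := by rw [ha]; positivity
  have hb0 : 0 ≤ b := by rw [hb]; positivity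
  have h1a : 0 < 1 - a := by linarith
  set q : ℝ := b / (1 - a) with hq
  have hq0 : 0 ≤ q := div_nonneg hb0 h1a.le
  have hq1 : q < 1 := by rw [hq, div_lt_one h1a]; linarith
  have hstep : ∀ n : ℤ, J n ≤ q * J (n - 1) := by
    intro n
    have h := action_sq_step_visc hε hν hW hc hC n
    rw [hq, div_mul_eq_mul_div, le_div_iff₀ h1a]
    simp only [hJ]
    linarith
  have hiter : ∀ (k : ℕ) (n : ℤ), J n ≤ q ^ k * (C * M) := by
    intro k
    induction k with
    | zero => intro n; simpa using hJB n
    | succ k ih =>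
      intro n
      calc J n ≤ q * J (n - 1) := hstep n
        _ ≤ q * (q ^ k * (C * M)) := mul_le_mul_of_nonneg_left (ih (n - 1)) hq0
        _ = q ^ (k + 1) * (C * M) := by ring
  have hJzero : ∀ n, J n = 0 := by
    intro n
    refine le_antisymm ?_ (hJ0 n)
    have hlim : Tendsto (fun k : ℕ => q ^ k * (C * M)) atTop (𝓝 (0 * (C * M))) :=
      (tendsto_pow_atTop_nhds_zero_of_lt_one hq0 hq1).mul_const _
    rw [zero_mul] at hlim
    exact ge_of_tendsto' hlim fun k => hiter k n
  intro n σ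
  have hE := integrable_norm_sq_visc hW hC n
  have hae : (fun σ => ‖W n σ‖ ^ 2) =ᵐ[volume] 0 :=
    (integral_eq_zero_iff_of_nonneg (fun σ => by positivity) hE).1 (hJzero n)
  have hcont : Continuous (fun σ => ‖W n σ‖ ^ 2) := ((WakeRatchetOrthant.continuous_shell hW n).norm).pow 2
  have hzero := congrFun ((Continuous.ae_eq_iff_eq volume hcont continuous_const).1 hae) σ
  have h0 : ‖W n σ‖ ^ 2 = 0 := hzero
  exact norm_eq_zero.1 ((pow_eq_zero_iff two_ne_zero).1 h0)

/-- **Gap theorem for every covariant viscosity `ν̂ ≥ 0`** (`ε₀ > 0`): a uniformly bounded admissible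
eternal solution `W` (`IsEternalVisc ε₀ ν̂ α W`) of a cancelling table with
`(Λ + Λ⁻¹)·fluxConst α·C < 1` for a uniform bound `C` is identically zero.
[cite: Tao2016AveragedNS, §4 (4.1)–(4.3), Lemma 4.1 (4.8)–(4.10), viscous equation before Thm. 4.2, §6.4; cell theorem] -/
theorem eq_zero_of_small_bound_all (hε : 0 < ε₀) (hW : IsEternalVisc ε₀ νh α W)
    (hc : IsCancellingCoeff α) {C : ℝ} (hC : ∀ k σ, ‖W k σ‖ ≤ C)
    (hsmall : (bigLam ε₀ + (bigLam ε₀)⁻¹) * fluxConst α * C < 1) :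
    ∀ (n : ℤ) (σ : ℝ), W n σ = 0 := by
  rcases hW.nonneg.lt_or_eq with hν | hν
  · exact eq_zero_of_small_bound_visc hε hν hW hc hC hsmall
  · have hW0 : IsEternal ε₀ α W := by
      rw [← isEternalVisc_zero_iff]; rw [hν]; exact hW
    exact eq_zero_of_small_bound hε.le hW0 hc hC hsmall

/-- **The `ε₀`-uniform gap `1/576` on comparable tables, any viscosity.**  On a cancelling
`R`-comparable table (`m = 4`), `0 < ε₀ ≤ 1`, a non-trivial uniformly bounded admissible eternal
solution with any covariant viscosity `ν̂ ≥ 0` has every uniform bound `C > 1/576`.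
[cite: Tao2016AveragedNS, §4 (4.1)–(4.3), §6.1, §6.4; cell theorem] -/
theorem gap_comparable_all {ε₀ νh R : ℝ} {α : Fin 4 → Fin 4 → Fin 4 → ℤ × ℤ × ℤ → ℝ}
    {W : ℤ → ℝ → Em 4} (hε : 0 < ε₀) (hε1 : ε₀ ≤ 1) (hc : IsCancellingCoeff α)
    (hα : IsComparableCoeff R α) (hW : IsEternalVisc ε₀ νh α W) {C : ℝ}
    (hC : ∀ k σ, ‖W k σ‖ ≤ C) (hne : ∃ n σ, W n σ ≠ 0) : 1 / 576 < C := by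
  have h1 : 1 ≤ (bigLam ε₀ + (bigLam ε₀)⁻¹) * fluxConst α * C := by
    by_contra h
    push Not at h
    obtain ⟨n, σ, hnz⟩ := hne
    exact hnz (eq_zero_of_small_bound_all hε hW hc hC h n σ)
  have h9 := bigLam_add_inv_lt_nine hε.le hε1
  have h64 := WakeRatchetDSSAmplitudeFloor.fluxConst_le_64 hα
  have hf0 : 0 ≤ fluxConst α := (table_sTable α hc).CA_nonneg
  have hC0 : 0 ≤ C := (norm_nonneg _).trans (hC 0 0)
  rcases (mul_nonneg hf0 hC0).lt_or_eq with hpos | hzero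
  · have h2 : (bigLam ε₀ + (bigLam ε₀)⁻¹) * fluxConst α * C < 9 * (fluxConst α * C) := by
      rw [mul_assoc]; exact mul_lt_mul_of_pos_right h9 hpos
    have h3 : 9 * (fluxConst α * C) ≤ 9 * (64 * C) :=
      mul_le_mul_of_nonneg_left (mul_le_mul_of_nonneg_right h64 hC0) (by norm_num)
    rw [div_lt_iff₀ (by norm_num : (0 : ℝ) < 576)]
    linarith
  · exfalso
    rw [mul_assoc, ← hzero, mul_zero] at h1
    linarith

/-- **The gap in the crux's own vocabulary.**  For `R`-comparable symmetric cancelling tables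
(`InTableClass R α`), `0 < ε₀ ≤ 1`, any `ν̂`, every admissible eternal solution in the scope of
`WakeRatchet.TailRatchet` (`IsEternalVisc ε₀ ν̂ α W`; the clause `UniformBound W` is implied by the
negation of the conclusion and therefore not assumed) is either identically zero or has a shell value
of norm `> 1/576` — no witness against the tail ratchets is a small perturbation of `W = 0`. [cite: Tao2016AveragedNS, §4 (4.1)–(4.3), §6.1, §6.4; cell theorem] -/
theorem tailRatchet_scope_gap {ε₀ νh R : ℝ} {α : Fin 4 → Fin 4 → Fin 4 → ℤ × ℤ × ℤ → ℝ}
    {W : ℤ → ℝ → Em 4} (hε : 0 < ε₀) (hε1 : ε₀ ≤ 1) (hα : InTableClass R α)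
    (hW : IsEternalVisc ε₀ νh α W) (hne : ∃ n σ, W n σ ≠ 0) :
    ∃ (n : ℤ) (σ : ℝ), 1 / 576 < ‖W n σ‖ := by
  by_contra h
  push Not at h
  exact lt_irrefl _ (gap_comparable_all hε hε1 hα.2.1 hα.2.2 hW h hne)

end WakeRatchetEternalGapVisc

end Summit.NavierStokesRegularity.NavierStokesRegularity.Theorems

end
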